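import Literature.MathematicalPhysics.QuantumFieldTheory.Balaban1983to89.B15Prop1StdInstanceSU2Box
import Literature.MathematicalPhysics.QuantumFieldTheory.Balaban1983to89.B16Prop1IVFromProp4

/-!
# `Balaban1983to89.B15Prop1LipschitzFromProp4` — [Balaban1989LargeFieldII] p. 359 *«Using Proposition 4 [15] … The above equations, bounds
# and statements are valid for 𝔤ᶜ-valued fields»*: the Lipschitz letters (m3) of the N12∕s1 chain (real slice coordinates) SUPPLIED from
# Proposition 4 [15] in r08's typed form `B11Prop6Scheme.Prop4Hyp` on the complexified functional derivative, via r13's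
# `B16Prop1IVFromProp4.lipschitz_of_prop4Hyp` ([15]'s Cauchy step (119)–(120)) restricted to the real fields

statement-level skeleton of published theorems with citation tags; proofs where landed; nothing here is a claim about
the Yang–Mills mass gap

[Balaban1989LargeFieldII] p. 359 (PDF 5), verbatim: *"Using Proposition 4 [15] and the fixed point theorem for contractive mappings, we can
easily prove that the above equation has exactly one solution … The above equations, bounds and statements are valid for 𝔤ᶜ-valued fields,
hence the existence of the analytic extension follows immediately"*; [15] = [Balaban1985Variational] Proposition 4 p. 292: *"The functional
derivative of V(A′) is an analytic function on this space, and satisfies the estimate |((δ/δA′)V)(A′)| < C₄ε₃² …"* — IN THE TREE as r08's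
hypothesis structure `Prop4Hyp W C₄ a₃` (quadratic bound + Fréchet `ℂ`-differentiability on `‖Y‖ < a₃`; inhabited at the concrete
`W80 = (δ/δA′)V`, `B11Prop4ModelW80.prop4Printed_W80`), and r13's `lipschitz_of_prop4Hyp` (Lipschitz constant `4C₄(ρ + a)` on `‖u‖ ≤ ρ`).

Cell pub-ymgap, HUMAN RULING D-0062 (Track A full width), seat `pub-ymgap-dag-n12-c` (R134 acceleration seat (a), strategy s1 of DAG node
N12 = [B15], director's row *«… from the landed p.359 model (`B16Prop1IVAssembly…`, `bounds167_*`, `B11Prop4ModelW80`)»*; generation g3,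
fifth product).

WHAT THIS FILE PROVES (theorems only; Mathlib + the two imports; no `sorry`, no definition, no `… : Prop` fact; axioms standard).
§1 REAL RESTRICTION OF PROPOSITION 4: for a real normed space `F`, a complex normed space `F_ℂ`, a map `emb : F → F_ℂ` preserving distances
   with `emb 0 = 0` (the inclusion of the `𝔤`-valued into the `𝔤ᶜ`-valued fields), `W : F_ℂ → F_ℂ` with `Prop4Hyp W C₄ a₃` and `dV : F → F`
   with `W ∘ emb = emb ∘ dV`: **`dV_zero_real_of_prop4Hyp`** (`dV 0 = 0`) and **`lipschitz_real_of_prop4Hyp`** (`dV` is `4C₄(ρ + a)`-Lipschitz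
   on `‖u‖ ≤ ρ` when `2(ρ + a) ≤ a₃`, `a > 0`) — the letters `hdV0` ∕ `hdV` of `B15Prop1CarrierOnFromModel.prop1Printed_lfVarOn_of_model`.
§2 **`prop1Printed_lfVarOn_std_su2_box_of_prop4`** — the chain `B15Prop1StdInstanceSU2Box.prop1Printed_lfVarOn_std_su2_box` (p483252) with
   (m3) = `hdV0`, `hdV` REPLACED by the complexification data `emb`, `W` and `Prop4Hyp (W i V_k) (C₄ i) (a₃ i)`, the Lipschitz constant in the
   smallness `hsmall` becoming `ℓ = 4C₄(ρ + a)` (*«V is of third order»*: small for small fields).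

HONEST SCOPE.  (i) `W`, `emb`, `F_ℂ` are data (NODE 00's `(δ/δA)V` on 𝔤ᶜ-valued fields and the complexification of the slice's target);
`Prop4Hyp` is r08's HYPOTHESIS STRUCTURE for [15] Prop. 4, displayed here per instance and datum `V_k` — its lattice-uniform constants are r08's
declared caveat.  (ii) Remaining hypotheses of the N12∕s1 chain after this file: `hlead` (p. 357) + `hsm`∕`hγle`∕`hbxM`, (m2) `hH`∕`hHst`∕`hadj`,
`hW`∕`hWdV` (Prop. 4 [15] at NODE 00's objects), (m4) `hJ`, (m5)∕(c3) `hA`∕`hc3`, (181) `h181`, (x) `hAn`, `hρ`∕`ha₃`∕`hsmall`, thresholds.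
Count-neutral; NOT a discharge of N12; NOT summit progress; nothing continuum ∕ OS ∕ mass-gap ∕ Clay.
-/

noncomputable section

open Set Finset
open scoped BigOperators Matrix RealInnerProductSpace Real
open Classical

namespace Literature.MathematicalPhysics.QuantumFieldTheory.Balaban1983to89.B15Prop1LipschitzFromProp4

open B15DeterminingSets GaugeField B16Sect1Backgrounds B15Prop1Carrier B8Eq17ClassAkV1
open B15Prop1CarrierOnSU2Box B15Prop1SliceIneq18 B15Prop1CarrierOnSU2BoxIneq19 B15Prop1CarrierOnSU2BoxExt193 B15Prop1SliceIneq167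
open B15Prop1StdInstanceSU2Box
open T4CubeChartGnomonic (SU2)
open B15Prop1ChartSU2 (su2Chart)
open B15Prop1SliceCoordinates (GaugeSlice ιA freeBonds)
open T4AxialGaugeSmallField (castSite boxPlaqs)
open B7Prop1Explicit (e e_apply)
open B6BondElimination (unitVec unitVec_apply)
open B6TreeGaugePoincare (curl)
open B16Eq18Proof (box mem_box)
open B15Extension193 (extend)
open B15ShellGauge193 (shellGauge)
open B5Prop11Plancherel (Tor)
open B5Bounds167Lattice (formDk ofRealCfg)
open B14.Eq213DetSet B14.Eq216Concrete B14.Eq12InteriorLocality B15Sect1Instances B15Eq177GaugeInvariance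
open Literature.MathematicalPhysics.QuantumFieldTheory.BalabanImbrieJaffe1984to88.BIJ85Eq453GaugeField
open B11Prop6Scheme (Prop4Hyp)
open B16Prop1IVFromProp4 (dV_zero_of_prop4Hyp lipschitz_of_prop4Hyp)

/-! ## §1 Proposition 4 [15] restricted to the real fields -/

section Real

variable {F : Type*} [NormedAddCommGroup F] {Fc : Type*} [NormedAddCommGroup Fc] [NormedSpace ℂ Fc]

/-- **`(δ/δA)V(0) = 0` on the real fields** from Proposition 4 [15] on the 𝔤ᶜ-valued fields (r13's `dV_zero_of_prop4Hyp`) along a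
distance-preserving inclusion `emb` with `emb 0 = 0` and `W ∘ emb = emb ∘ dV`. [cite: Balaban1985Variational, Prop. 4 (98) p.293;
Balaban1989LargeFieldII, p.359] -/
theorem dV_zero_real_of_prop4Hyp (emb : F → Fc) (hemb : ∀ u v : F, ‖emb u - emb v‖ = ‖u - v‖) (hemb0 : emb 0 = 0)
    {W : Fc → Fc} {dV : F → F} {C₄ a₃ : ℝ} (hW : Prop4Hyp W C₄ a₃) (ha₃ : 0 < a₃) (hWdV : ∀ u, W (emb u) = emb (dV u)) :
    dV 0 = 0 := by
  have h0 : W 0 = 0 := dV_zero_of_prop4Hyp hW ha₃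
  have h1 : emb (dV 0) = emb 0 := by rw [← hWdV, hemb0, h0]
  have h2 : ‖dV 0 - 0‖ = 0 := by rw [← hemb, h1, sub_self, norm_zero]
  simpa using h2

/-- **THE LIPSCHITZ LETTER (m3) ON THE REAL FIELDS FROM PROPOSITION 4 [15]**: along a distance-preserving inclusion `emb : F → F_ℂ` with
`emb 0 = 0` and `W ∘ emb = emb ∘ dV`, `Prop4Hyp W C₄ a₃` gives `‖dV u − dV v‖ ≤ 4C₄(ρ + a)‖u − v‖` for `‖u‖, ‖v‖ ≤ ρ`, `a > 0`,
`2(ρ + a) ≤ a₃` — r13's `lipschitz_of_prop4Hyp` ([15] (119)–(120)) read on the image of `emb`. [cite: Balaban1985Variational, (119)-(120)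
p.295, Prop. 4 (98) p.293; Balaban1989LargeFieldII, p.359] -/
theorem lipschitz_real_of_prop4Hyp (emb : F → Fc) (hemb : ∀ u v : F, ‖emb u - emb v‖ = ‖u - v‖) (hemb0 : emb 0 = 0)
    {W : Fc → Fc} {dV : F → F} {C₄ a₃ ρ a : ℝ} (hW : Prop4Hyp W C₄ a₃) (hC₄ : 0 ≤ C₄) (ha : 0 < a) (hρ : 0 ≤ ρ)
    (hdom : 2 * (ρ + a) ≤ a₃) (hWdV : ∀ u, W (emb u) = emb (dV u)) :
    ∀ u v : F, ‖u‖ ≤ ρ → ‖v‖ ≤ ρ → ‖dV u - dV v‖ ≤ 4 * C₄ * (ρ + a) * ‖u - v‖ := by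
  intro u v hu hv
  have hn : ∀ w : F, ‖emb w‖ = ‖w‖ := fun w => by
    have := hemb w 0
    rwa [hemb0, sub_zero, sub_zero] at this
  have h := lipschitz_of_prop4Hyp hW hC₄ ha hρ hdom (emb u) (emb v) (by rw [hn]; exact hu) (by rw [hn]; exact hv)
  rw [hWdV, hWdV, hemb, hemb] at h
  exact h

end Real

/-! ## §2 The chain at print's instance with Proposition 4 [15] consumed in r08's typed form -/

section Knit

variable {P : Params}

/-- **PROPOSITION 1 [IV] FOR PRINT'S FUNCTION (1.77) AT `SU(2)` ON PARALLELEPIPEDS, (m3) FROM PROPOSITION 4 [15]**: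
`B15Prop1StdInstanceSU2Box.prop1Printed_lfVarOn_std_su2_box` with the Lipschitz letters `hdV0`, `hdV` SUPPLIED by §1 from
`Prop4Hyp (W i V_k) (C₄ i) (a₃ i)` on the complexified functional derivative (`W ∘ emb = emb ∘ dV`), `ℓ = 4C₄(ρ + a)` in the smallness.
[cite: Balaban1989LargeFieldI, Prop. 1 (1.77)–(1.78) p.194; Balaban1989LargeFieldII, pp.357–359; Balaban1985Variational, Prop. 4 (97)–(98)
pp.292–293, (119)-(120) p.295, (181) p.307] -/
theorem prop1Printed_lfVarOn_std_su2_box_of_prop4 (hd3 : 3 ≤ P.d) (h0 : 0 < P.d) {ι : Type} {av : ∀ j, Averaging P j SU2}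
    (bg : DetBackground P SU2 av) (M₁ : ℕ) (Z Λ : ι → Set (Site P 0)) (k : ι → ℕ) (M a₁ : ι → ℝ)
    (An : ∀ i, ℝ → GaugeField P (k i) SU2 → Prop) (hk : ∀ i, k i ≤ P.m + P.K)
    -- (c3″) REPLACED by the [15] (181) covariance of the solution map at print's instance (`B15Prop1Carrier.std_f_gaugeAct`)
    (h181 : ∀ i (u : GaugeTransf P (k i) SU2), Cov181 bg (Bj M₁ (Z i) (k i)) (blockLift (k i) u))
    (T : ∀ i, Finset (PBond P (k i)))
    {F : ι → Type*} [∀ i, NormedAddCommGroup (F i)] [∀ i, InnerProductSpace ℝ (F i)]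
    (H : ∀ i, GaugeField P (k i) SU2 →
      (GaugeSlice (pts (k i) (Λ i)) (T i) (EuclideanSpace ℝ (Fin 3)) →ₗ[ℝ] F i))
    (Hst : ∀ i, GaugeField P (k i) SU2 →
      (F i →ₗ[ℝ] GaugeSlice (pts (k i) (Λ i)) (T i) (EuclideanSpace ℝ (Fin 3))))
    (hadj : ∀ i Vk (x : GaugeSlice (pts (k i) (Λ i)) (T i) (EuclideanSpace ℝ (Fin 3))) (y : F i),
      ⟪H i Vk x, y⟫ = ⟪x, Hst i Vk y⟫)
    (Δ₁ : ∀ i, GaugeField P (k i) SU2 → (F i →ₗ[ℝ] F i)) (dV : ∀ i, GaugeField P (k i) SU2 → F i → F i)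
    -- (m3) REPLACED by Proposition 4 [15] in r08's typed form on the COMPLEXIFIED functional derivative `W = (δ/δA)V` on 𝔤ᶜ-valued
    -- fields (p. 359: «valid for 𝔤ᶜ-valued fields»), restricting to `dV` along an isometric embedding `emb` of the real fields
    {Fc : ι → Type*} [∀ i, NormedAddCommGroup (Fc i)] [∀ i, NormedSpace ℂ (Fc i)] (emb : ∀ i, F i → Fc i)
    (hemb : ∀ i (u v : F i), ‖emb i u - emb i v‖ = ‖u - v‖) (hemb0 : ∀ i, emb i 0 = 0)
    (W : ∀ i, GaugeField P (k i) SU2 → Fc i → Fc i) {C₄ a₃ a : ι → ℝ} (hC₄ : ∀ i, 0 ≤ C₄ i) (ha : ∀ i, 0 < a i)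
    (hW : ∀ i Vk, Prop4Hyp (W i Vk) (C₄ i) (a₃ i)) (hWdV : ∀ i Vk (u : F i), W i Vk (emb i u) = emb i (dV i Vk u))
    (J : ∀ i, GaugeField P (k i) SU2 → F i)
    (lo hi : ι → Fin P.d → ℤ) (n : ι → ℕ) (hn : ∀ i κ, hi i κ ≤ lo i κ + n i) (hN : ∀ i, n i + 2 < P.sitesPerDir (k i))
    (hbox : ∀ i, pts (k i) (Λ i) = (castSite '' Set.Icc (lo i) (hi i) : Set (Site P (k i))))
    (hZ : ∀ i, (boxPlaqs (lo i - 1) (hi i + 1) : Set (Plaq P (k i))) ⊆ plaqsInside (pts (k i) (Z i)))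
    (hTG0 : ∀ i, T i = (box (fun κ => (hi i κ - lo i κ + 1).toNat) (lo i)).image fun x =>
      (⟨castSite (x - unitVec ⟨0, h0⟩), ⟨0, h0⟩⟩ : PBond P (k i)))
    (hN5 : ∀ i κ, ((hi i κ - lo i κ + 1).toNat : ℤ) + 5 < P.sitesPerDir (k i))
    (K : ι → ℕ) (hK1 : ∀ i, 1 ≤ K i) (hKn : ∀ i κ, (hi i κ - lo i κ + 1).toNat ≤ K i)
    (ext : ∀ i, GaugeField P (k i) SU2 → GaugeField P (k i) SU2)
    -- (ℓ2) REPLACED: the extension is r12's p. 193 shell-gauge extension, `Λ` non-degenerate, constant bookkeeping `hbxM`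
    (hext : ∀ i Vk, ext i Vk = extend (pts (k i) (Λ i)) (shellGauge Vk (lo i) (hi i)) Vk)
    (hlohi : ∀ i, lo i ≤ hi i)
    {γ h₁ hst cJ bx : ℝ} (hγ : 0 < γ) (hh₁ : 0 ≤ h₁) (hhst : 0 ≤ hst) (hcJ : 0 ≤ cJ) (hbx : 0 ≤ bx)
    (hbxM : ∀ i, 12 * (P.d : ℝ) * ((n i : ℝ) + 2) ^ 2 ≤ bx * (M i) ^ 2)
    {ρ r eA eD δc Cerr : ι → ℝ} (hr : ∀ i, 0 < r i) (heA : ∀ i, 0 < eA i) (heD : ∀ i, 0 < eD i)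
    (hδc : ∀ i, 0 < δc i) (ha₁ : ∀ i, 0 ≤ a₁ i) (hM : ∀ i, 1 ≤ (M i))
    (n' : ι → ℕ) (hn' : ∀ i, 1 ≤ n' i)
    (hlead : ∀ i Vk (X : GaugeSlice (pts (k i) (Λ i)) (T i) (EuclideanSpace ℝ (Fin 3))),
      |⟪H i Vk X, Δ₁ i Vk (H i Vk X)⟫ -
          ∑ a : Fin 3, formDk (n' i) (fun _ : Fin P.d => P.sitesPerDir (k i))
            (ofRealCfg (fun _ : Fin P.d => P.sitesPerDir (k i)) fun j =>
              ιA (pts (k i) (Λ i)) (T i) X ⟨j.1, j.2⟩ a)| ≤ Cerr i * ‖X‖ ^ 2)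
    (hsm : ∀ i, Cerr i ≤ (4 / Real.pi ^ 2) ^ (P.d + 2) / (2 * (3 * (K i : ℝ) ^ 2 + 2 * (K i : ℝ) ^ 4)))
    (hγle : ∀ i, γ / (M i) ^ 5 ≤ (4 / Real.pi ^ 2) ^ (P.d + 2) / (2 * (3 * (K i : ℝ) ^ 2 + 2 * (K i : ℝ) ^ 4)))
    (hH : ∀ i Vk x, ‖H i Vk x‖ ≤ h₁ * ‖x‖) (hHst : ∀ i Vk z, ‖Hst i Vk z‖ ≤ hst * ‖z‖)
    (hρ : ∀ i, h₁ * r i ≤ ρ i) (ha₃ : ∀ i, 2 * (ρ i + a i) ≤ a₃ i)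
    (hsmall : ∀ i, (M i) ^ 5 / γ * hst * (4 * C₄ i * (ρ i + a i)) * h₁ ≤ 1 / 2)
    (hA : ∀ i Vk (X δ : GaugeSlice (pts (k i) (Λ i)) (T i) (EuclideanSpace ℝ (Fin 3))),
      HasDerivAt (fun s : ℝ => (fun177std bg M₁ (Z i) (k i)) (expMul su2Chart (ιA (pts (k i) (Λ i)) (T i) (X + s • δ)) (ext i Vk)))
      (⟪δ, Hst i Vk (J i Vk)⟫ + ⟪δ, Hst i Vk (Δ₁ i Vk (H i Vk X))⟫ + ⟪δ, Hst i Vk (dV i Vk (H i Vk X))⟫) 0)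
    (hJ : ∀ i ε Vk, 0 < ε → (lfVarOn su2Chart fun i => InstOn.std bg M₁ (Z i) (Λ i) (k i) (M i) (a₁ i) (An i)).Regular i ε Vk → ‖J i Vk‖ ≤ cJ * ε)
    (hc3 : ∀ i Vk (B : GaugeSlice (pts (k i) (Λ i)) (T i) (EuclideanSpace ℝ (Fin 3))), ‖B‖ ≤ r i →
      (IsCriticalPt su2Chart (bondsOf (pts (k i) (Λ i))) (fun177std bg M₁ (Z i) (k i))
          (expMul su2Chart (ιA (pts (k i) (Λ i)) (T i) B) (ext i Vk)) ↔
        ∀ δB : GaugeSlice (pts (k i) (Λ i)) (T i) (EuclideanSpace ℝ (Fin 3)),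
          ⟪δB, Hst i Vk (J i Vk)⟫ + ⟪δB, Hst i Vk (Δ₁ i Vk (H i Vk B))⟫ + ⟪δB, Hst i Vk (dV i Vk (H i Vk B))⟫ = 0))
    (hAn : ∀ i ε Vk, 0 < ε → ε ≤ eA i → (lfVarOn su2Chart fun i => InstOn.std bg M₁ (Z i) (Λ i) (k i) (M i) (a₁ i) (An i)).Regular i ε Vk → (An i) ε Vk)
    -- thresholds (`N i = √|free bonds|`)
    (hN' : ∀ i, Real.sqrt (freeBonds (pts (k i) (Λ i)) (T i)).card * (π / 2 * δc i) ≤ r i)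
    (hδ : ∀ i ε, 0 < ε → ε ≤ eD i →
      ((n i : ℝ) + 2) * ((n i : ℝ) + P.d) * (a₁ i + (bx * (M i) ^ 2 * ε + ε)) < δc i)
    (he1 : ∀ i ε, 0 < ε → ε ≤ eD i → (4 * 1 * (2 * (M i) ^ 5 * hst * cJ / γ) + bx * (M i) ^ 2) * ε < a₁ i) :
    B15.Prop1Printed (lfVarOn su2Chart fun i => InstOn.std bg M₁ (Z i) (Λ i) (k i) (M i) (a₁ i) (An i)) := by

  have hρ0 : ∀ i, 0 ≤ ρ i := fun i => (mul_nonneg hh₁ (hr i).le).trans (hρ i)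
  exact prop1Printed_lfVarOn_std_su2_box hd3 h0 bg M₁ Z Λ k M a₁ An hk h181 T H Hst hadj Δ₁ dV J lo hi n hn hN hbox hZ hTG0
    hN5 K hK1 hKn ext hext hlohi hγ hh₁ hhst hcJ hbx hbxM (fun i => by have := hC₄ i; have := ha i; have := hρ0 i; positivity)
    hr heA heD hδc ha₁ hM n' hn' hlead hsm hγle hH hHst
    (fun i Vk => dV_zero_real_of_prop4Hyp (emb i) (hemb i) (hemb0 i) (hW i Vk) (by linarith [ha₃ i, ha i, hρ0 i]) (hWdV i Vk))
    (fun i Vk => lipschitz_real_of_prop4Hyp (emb i) (hemb i) (hemb0 i) (hW i Vk) (hC₄ i) (ha i) (hρ0 i) (ha₃ i) (hWdV i Vk))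
    hρ hsmall hA hJ hc3 hAn hN' hδ he1

end Knit

end Literature.MathematicalPhysics.QuantumFieldTheory.Balaban1983to89.B15Prop1LipschitzFromProp4

end
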